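import Mathlib.Analysis.SpecialFunctions.Sqrt
import Mathlib.Analysis.SpecialFunctions.Pow.Deriv
import Mathlib.Analysis.Calculus.Deriv.Inv
import Mathlib.Analysis.Calculus.Deriv.Inverse
import HarnessLib

/-!
# Forstnerič–Kozak's shape inequalities: the `|x|, |y|` form and its behaviour under inversion

Topic `Literature/Geometry/Symplectic`; proofs file of the fact seat of
`Literature.Geometry.Symplectic.Gompf1998_thm13_twoHandles` (**E2**, `SteinTwoHandles.lean`),
companion of `SteinShapeCriterion.lean` (Forstnerič–Kozak 2003, Prop. 2.1: the domain
`{|y|² < θ(|x|²)} ⊂ ℂ²` is strongly pseudoconvex along `{|y|² = θ(|x|²)}` when `θ' < 1` and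
`2|x|²θθ'' < (1 - θ')(|x|²θ'² + θ)`, the domain `{|y|² > θ(|x|²)}` when the reverse
inequalities hold).  Eliashberg's standard handle (Eliashberg 1990, Lemma 3.4.3 =
Forstnerič–Kozak, Prop. 3.1 and Cor. 3.2) is the domain `K = {|x| ≤ f⁻¹(|y|)}` for an
explicit increasing profile `f`, and its strong pseudoconvexity is checked on `f` through two
reformulations of the criterion, both proved here as printed:

* **Cor. 2.2** (the variables `|x|, |y|`): writing `θ(t²) = f(t)²`, *"the second inequality in
  (2.2) is equivalent to `f (f'' + f'³/|x|) < 1`"* and `θ' < 1` to `f f'/|x| < 1`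
  (`shape_theta_iff`, from `θ' = f f'/t`, `2t²θ'' = f f'' + f'² - f f'/t`:
  `hasDerivAt_sq_comp_sqrt`, `hasDerivAt_deriv_sq_comp_sqrt`); the reverse inequalities
  likewise (`shape_theta_rev_iff`);
* **Remark 2.3 (A)** (inversion): at points where `f' > 0` the inequalities
  `f (f'' + f'³/t) > 1`, `f f'/t > 1` for `f` at `t` are *equivalent* to the inequalities
  `h (h'' + h'³/u) < 1`, `h h'/u < 1` for the inverse function `h = f⁻¹` at `u = f(t)`
  (`shape_inverse_iff`, with `h' = 1/f'`, `h'' = -f''/f'³`: `hasDerivAt_inverse`,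
  `hasDerivAt_deriv_inverse`) — *"the inequalities (2.2) transform into the reverse
  inequalities for `τ`"*.

Pure one-variable calculus and algebra; everything is **proved**, no definition, no named fact.

## References

* F. Forstnerič, J. Kozak, *Strongly pseudoconvex handlebodies*, J. Korean Math. Soc. 40
  (2003), 727–745 (arXiv:math/0305237), Cor. 2.2, Remark 2.3 (A), Prop. 3.1 (iv).
  [ForstnericKozak2003]
* Ya. Eliashberg, *Topological characterization of Stein manifolds of dimension > 2*,
  Internat. J. Math. 1 (1990), 29–46, Lemma 3.4.3. [Eliashberg1990Stein]
-/

noncomputable section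

open Set Filter
open scoped Topology

namespace Literature.Geometry.Symplectic

/-! ### §1 Cor. 2.2: from `θ(|x|²)` to `f(|x|)` -/

/-- **The algebra of Cor. 2.2.**  With `θ = a²`, `θ' = a b / r`, `2 s θ'' = a d + b² - a b / r`
(`s = r²`; `a = f(r) > 0`, `b = f'(r)`, `d = f''(r)`), the inequalities
`θ' < 1 ∧ 2 s θ θ'' < (1 - θ')(s θ'² + θ)` are equivalent to `a b / r < 1 ∧ a (d + b³/r) < 1`.
[cite: ForstnericKozak2003, Cor. 2.2] -/
theorem shape_theta_alg_iff {a b d r Θ' Θ'' : ℝ} (ha : 0 < a) (hr : 0 < r)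
    (hΘ' : Θ' = a * b / r) (hΘ'' : 2 * r ^ 2 * Θ'' = a * d + b ^ 2 - a * b / r) :
    (Θ' < 1 ∧ 2 * r ^ 2 * (a ^ 2) * Θ'' < (1 - Θ') * (r ^ 2 * Θ' ^ 2 + a ^ 2)) ↔
      (a * b / r < 1 ∧ a * (d + b ^ 3 / r) < 1) := by
  have ha2 : 0 < a ^ 2 := by positivity
  have key : 2 * r ^ 2 * (a ^ 2) * Θ'' - (1 - Θ') * (r ^ 2 * Θ' ^ 2 + a ^ 2) =
      a ^ 2 * (a * (d + b ^ 3 / r) - 1) := by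
    have h1 : 2 * r ^ 2 * (a ^ 2) * Θ'' = a ^ 2 * (a * d + b ^ 2 - a * b / r) := by
      rw [← hΘ'']; ring
    rw [h1, hΘ']
    field_simp
    ring
  constructor
  · rintro ⟨h1, h2⟩
    refine ⟨by rwa [hΘ'] at h1, ?_⟩
    have h3 : a ^ 2 * (a * (d + b ^ 3 / r) - 1) < 0 := by rw [← key]; linarith
    have h4 : a * (d + b ^ 3 / r) - 1 < 0 := by
      by_contra h5
      have h6 := mul_nonneg ha2.le (not_lt.1 h5)
      linarith
    linarith
  · rintro ⟨h1, h2⟩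
    refine ⟨by rwa [hΘ'], ?_⟩
    have h3 : a ^ 2 * (a * (d + b ^ 3 / r) - 1) < 0 := mul_neg_of_pos_of_neg ha2 (by linarith)
    rw [← key] at h3
    linarith

/-- **The algebra of Cor. 2.2, reverse inequalities** (the domain `{|y|² > θ(|x|²)}`):
`θ' > 1 ∧ 2 s θ θ'' > (1 - θ')(s θ'² + θ)` iff `a b / r > 1 ∧ a (d + b³/r) > 1`.
[cite: ForstnericKozak2003, Cor. 2.2] -/
theorem shape_theta_alg_rev_iff {a b d r Θ' Θ'' : ℝ} (ha : 0 < a) (hr : 0 < r)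
    (hΘ' : Θ' = a * b / r) (hΘ'' : 2 * r ^ 2 * Θ'' = a * d + b ^ 2 - a * b / r) :
    (1 < Θ' ∧ (1 - Θ') * (r ^ 2 * Θ' ^ 2 + a ^ 2) < 2 * r ^ 2 * (a ^ 2) * Θ'') ↔
      (1 < a * b / r ∧ 1 < a * (d + b ^ 3 / r)) := by
  have ha2 : 0 < a ^ 2 := by positivity
  have key : 2 * r ^ 2 * (a ^ 2) * Θ'' - (1 - Θ') * (r ^ 2 * Θ' ^ 2 + a ^ 2) =
      a ^ 2 * (a * (d + b ^ 3 / r) - 1) := by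
    have h1 : 2 * r ^ 2 * (a ^ 2) * Θ'' = a ^ 2 * (a * d + b ^ 2 - a * b / r) := by
      rw [← hΘ'']; ring
    rw [h1, hΘ']
    field_simp
    ring
  constructor
  · rintro ⟨h1, h2⟩
    refine ⟨by rwa [hΘ'] at h1, ?_⟩
    have h3 : 0 < a ^ 2 * (a * (d + b ^ 3 / r) - 1) := by rw [← key]; linarith
    have h4 : 0 < a * (d + b ^ 3 / r) - 1 := by
      by_contra h5
      have h6 := mul_nonpos_of_nonneg_of_nonpos ha2.le (not_lt.1 h5)
      linarith
    linarith
  · rintro ⟨h1, h2⟩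
    refine ⟨by rwa [hΘ'], ?_⟩
    have h3 : 0 < a ^ 2 * (a * (d + b ^ 3 / r) - 1) := mul_pos ha2 (by linarith)
    rw [← key] at h3
    linarith

/-- **`θ(s) = f(√s)²` has derivative `f f'/r` at `s = r² > 0`** (`r = √s`).
[cite: ForstnericKozak2003, Cor. 2.2] -/
theorem hasDerivAt_sq_comp_sqrt {f : ℝ → ℝ} {b s : ℝ} (hs : 0 < s)
    (hf : HasDerivAt f b (Real.sqrt s)) :
    HasDerivAt (fun s => f (Real.sqrt s) ^ 2) (f (Real.sqrt s) * b / Real.sqrt s) s := by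
  have hr : 0 < Real.sqrt s := Real.sqrt_pos.2 hs
  have h1 : HasDerivAt Real.sqrt (1 / (2 * Real.sqrt s)) s := Real.hasDerivAt_sqrt hs.ne'
  have h2 : HasDerivAt (fun s => f (Real.sqrt s)) (b * (1 / (2 * Real.sqrt s))) s := hf.comp s h1
  have h3 : HasDerivAt (fun s => f (Real.sqrt s) * f (Real.sqrt s))
      (b * (1 / (2 * Real.sqrt s)) * f (Real.sqrt s) +
        f (Real.sqrt s) * (b * (1 / (2 * Real.sqrt s)))) s := h2.mul h2
  have h4 : (fun s => f (Real.sqrt s) ^ 2) = fun s => f (Real.sqrt s) * f (Real.sqrt s) := by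
    funext s; ring
  rw [h4]
  refine h3.congr_deriv ?_
  have hr0 : Real.sqrt s ≠ 0 := hr.ne'
  field_simp
  ring

/-- **The second derivative of `θ(s) = f(√s)²`**: if near `s₀ = r₀² > 0` the function `f` is
differentiable with derivative `f'`, and `f'` has derivative `d` at `r₀ = √s₀`, then the
derivative `θ' : s ↦ f(√s) f'(√s)/√s` has derivative `Θ''` at `s₀` with
`2 s₀ Θ'' = f d + f'² - f f'/r₀` (all at `r₀`). [cite: ForstnericKozak2003, Cor. 2.2] -/
theorem hasDerivAt_deriv_sq_comp_sqrt {f f' : ℝ → ℝ} {d s₀ : ℝ} (hs : 0 < s₀)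
    (hf : ∀ᶠ r in 𝓝 (Real.sqrt s₀), HasDerivAt f (f' r) r) (hf' : HasDerivAt f' d (Real.sqrt s₀)) :
    HasDerivAt (fun s => f (Real.sqrt s) * f' (Real.sqrt s) / Real.sqrt s)
      ((f (Real.sqrt s₀) * d + f' (Real.sqrt s₀) ^ 2 -
          f (Real.sqrt s₀) * f' (Real.sqrt s₀) / Real.sqrt s₀) / (2 * s₀)) s₀ := by
  set r₀ := Real.sqrt s₀ with hr₀
  have hr : 0 < r₀ := Real.sqrt_pos.2 hs
  have hsq : HasDerivAt Real.sqrt (1 / (2 * r₀)) s₀ := Real.hasDerivAt_sqrt hs.ne'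
  -- the function `F = f f' / id` of `r`, differentiated at `r₀`
  have hF : HasDerivAt (fun r => f r * f' r / r)
      (((f' r₀ * f' r₀ + f r₀ * d) * r₀ - f r₀ * f' r₀ * 1) / r₀ ^ 2) r₀ := by
    have h1 : HasDerivAt f (f' r₀) r₀ := hf.self_of_nhds
    have h2 : HasDerivAt (fun r => f r * f' r) (f' r₀ * f' r₀ + f r₀ * d) r₀ := h1.mul hf'
    exact h2.div (hasDerivAt_id r₀) hr.ne'
  have hcomp := hF.comp s₀ hsq
  have hr2 : r₀ ^ 2 = s₀ := Real.sq_sqrt hs.le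
  have hr0 : r₀ ≠ 0 := hr.ne'
  refine hcomp.congr_deriv ?_
  rw [← hr2]
  field_simp
  ring

/-- **Cor. 2.2 of Forstnerič–Kozak at a point.**  Let `s₀ = r₀² > 0`, `θ(s) = f(√s)²` with
`f(r₀) > 0`, `f` differentiable near `r₀` with derivative `f'`, `f'` differentiable at `r₀`
with derivative `d`.  Then, with `Θ' = θ'(s₀)` and `Θ'' = θ''(s₀)` the actual derivatives,
`θ'(s₀) < 1 ∧ 2 s₀ θ θ'' < (1 - θ')(s₀ θ'² + θ)` iff `f f'/r₀ < 1 ∧ f (d + f'³/r₀) < 1`.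
[cite: ForstnericKozak2003, Cor. 2.2] -/
theorem shape_theta_iff {f f' : ℝ → ℝ} {d s₀ : ℝ} (hs : 0 < s₀) (hpos : 0 < f (Real.sqrt s₀))
    (hf : ∀ᶠ r in 𝓝 (Real.sqrt s₀), HasDerivAt f (f' r) r) (hf' : HasDerivAt f' d (Real.sqrt s₀)) :
    (deriv (fun s => f (Real.sqrt s) ^ 2) s₀ < 1 ∧
      2 * s₀ * f (Real.sqrt s₀) ^ 2 * deriv (deriv fun s => f (Real.sqrt s) ^ 2) s₀ <
        (1 - deriv (fun s => f (Real.sqrt s) ^ 2) s₀) *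
          (s₀ * deriv (fun s => f (Real.sqrt s) ^ 2) s₀ ^ 2 + f (Real.sqrt s₀) ^ 2)) ↔
    (f (Real.sqrt s₀) * f' (Real.sqrt s₀) / Real.sqrt s₀ < 1 ∧
      f (Real.sqrt s₀) * (d + f' (Real.sqrt s₀) ^ 3 / Real.sqrt s₀) < 1) := by
  set r₀ := Real.sqrt s₀ with hr₀
  have hr : 0 < r₀ := Real.sqrt_pos.2 hs
  have hr2 : r₀ ^ 2 = s₀ := Real.sq_sqrt hs.le
  -- `θ'` near `s₀`
  have hθ' : ∀ᶠ s in 𝓝 s₀, HasDerivAt (fun s => f (Real.sqrt s) ^ 2)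
      (f (Real.sqrt s) * f' (Real.sqrt s) / Real.sqrt s) s := by
    have hc : ContinuousAt Real.sqrt s₀ := Real.continuous_sqrt.continuousAt
    have h1 : ∀ᶠ s in 𝓝 s₀, HasDerivAt f (f' (Real.sqrt s)) (Real.sqrt s) := hc.eventually hf
    have h2 : ∀ᶠ s in 𝓝 s₀, 0 < s := Ioi_mem_nhds hs
    filter_upwards [h1, h2] with s h1 h2
    exact hasDerivAt_sq_comp_sqrt h2 h1
  have hd1 : deriv (fun s => f (Real.sqrt s) ^ 2) s₀ = f r₀ * f' r₀ / r₀ :=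
    (hθ'.self_of_nhds).deriv
  have hd1f : deriv (fun s => f (Real.sqrt s) ^ 2) =ᶠ[𝓝 s₀]
      fun s => f (Real.sqrt s) * f' (Real.sqrt s) / Real.sqrt s := by
    filter_upwards [hθ'] with s h using h.deriv
  have hd2 : deriv (deriv fun s => f (Real.sqrt s) ^ 2) s₀ =
      (f r₀ * d + f' r₀ ^ 2 - f r₀ * f' r₀ / r₀) / (2 * s₀) := by
    rw [Filter.EventuallyEq.deriv_eq hd1f]
    exact (hasDerivAt_deriv_sq_comp_sqrt hs hf hf').deriv
  rw [hd1, hd2, ← hr2]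
  refine shape_theta_alg_iff (Θ'' := (f r₀ * d + f' r₀ ^ 2 - f r₀ * f' r₀ / r₀) / (2 * r₀ ^ 2))
    hpos hr rfl ?_
  field_simp

/-- **Cor. 2.2, reverse inequalities** (the domain `{|y|² > θ(|x|²)}`), same setting:
`θ' > 1 ∧ (1 - θ')(s₀θ'² + θ) < 2 s₀ θ θ''` iff `f f'/r₀ > 1 ∧ f (d + f'³/r₀) > 1`.
[cite: ForstnericKozak2003, Cor. 2.2] -/
theorem shape_theta_rev_iff {f f' : ℝ → ℝ} {d s₀ : ℝ} (hs : 0 < s₀) (hpos : 0 < f (Real.sqrt s₀))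
    (hf : ∀ᶠ r in 𝓝 (Real.sqrt s₀), HasDerivAt f (f' r) r) (hf' : HasDerivAt f' d (Real.sqrt s₀)) :
    (1 < deriv (fun s => f (Real.sqrt s) ^ 2) s₀ ∧
      (1 - deriv (fun s => f (Real.sqrt s) ^ 2) s₀) *
          (s₀ * deriv (fun s => f (Real.sqrt s) ^ 2) s₀ ^ 2 + f (Real.sqrt s₀) ^ 2) <
        2 * s₀ * f (Real.sqrt s₀) ^ 2 * deriv (deriv fun s => f (Real.sqrt s) ^ 2) s₀) ↔
    (1 < f (Real.sqrt s₀) * f' (Real.sqrt s₀) / Real.sqrt s₀ ∧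
      1 < f (Real.sqrt s₀) * (d + f' (Real.sqrt s₀) ^ 3 / Real.sqrt s₀)) := by
  set r₀ := Real.sqrt s₀ with hr₀
  have hr : 0 < r₀ := Real.sqrt_pos.2 hs
  have hr2 : r₀ ^ 2 = s₀ := Real.sq_sqrt hs.le
  have hθ' : ∀ᶠ s in 𝓝 s₀, HasDerivAt (fun s => f (Real.sqrt s) ^ 2)
      (f (Real.sqrt s) * f' (Real.sqrt s) / Real.sqrt s) s := by
    have hc : ContinuousAt Real.sqrt s₀ := Real.continuous_sqrt.continuousAt
    have h1 : ∀ᶠ s in 𝓝 s₀, HasDerivAt f (f' (Real.sqrt s)) (Real.sqrt s) := hc.eventually hf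
    have h2 : ∀ᶠ s in 𝓝 s₀, 0 < s := Ioi_mem_nhds hs
    filter_upwards [h1, h2] with s h1 h2
    exact hasDerivAt_sq_comp_sqrt h2 h1
  have hd1 : deriv (fun s => f (Real.sqrt s) ^ 2) s₀ = f r₀ * f' r₀ / r₀ :=
    (hθ'.self_of_nhds).deriv
  have hd1f : deriv (fun s => f (Real.sqrt s) ^ 2) =ᶠ[𝓝 s₀]
      fun s => f (Real.sqrt s) * f' (Real.sqrt s) / Real.sqrt s := by
    filter_upwards [hθ'] with s h using h.deriv
  have hd2 : deriv (deriv fun s => f (Real.sqrt s) ^ 2) s₀ =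
      (f r₀ * d + f' r₀ ^ 2 - f r₀ * f' r₀ / r₀) / (2 * s₀) := by
    rw [Filter.EventuallyEq.deriv_eq hd1f]
    exact (hasDerivAt_deriv_sq_comp_sqrt hs hf hf').deriv
  rw [hd1, hd2, ← hr2]
  refine shape_theta_alg_rev_iff (Θ'' := (f r₀ * d + f' r₀ ^ 2 - f r₀ * f' r₀ / r₀) / (2 * r₀ ^ 2))
    hpos hr rfl ?_
  field_simp

/-! ### §2 Remark 2.3 (A): the inequalities under inversion -/

/-- **The algebra of Remark 2.3 (A).**  With `u = f(t) > 0`, `t > 0`, `p = f'(t) > 0`,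
`q = f''(t)`, and the derivatives of the inverse `h = f⁻¹` at `u`: `h(u) = t`, `h'(u) = 1/p`,
`h''(u) = -q/p³`, one has
`(u (q + p³/t) > 1 ∧ u p/t > 1) ↔ (t (-q/p³ + (1/p)³/u) < 1 ∧ t (1/p)/u < 1)`.
[cite: ForstnericKozak2003, Remark 2.3 (A)] -/
theorem shape_inverse_alg_iff {t u p q : ℝ} (ht : 0 < t) (hu : 0 < u) (hp : 0 < p) :
    (1 < u * (q + p ^ 3 / t) ∧ 1 < u * p / t) ↔
      (t * (-q / p ^ 3 + (1 / p) ^ 3 / u) < 1 ∧ t * (1 / p) / u < 1) := by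
  have hp3 : 0 < p ^ 3 := by positivity
  have e1 : t * (1 / p) / u = t / (u * p) := by field_simp
  have e2 : t * (-q / p ^ 3 + (1 / p) ^ 3 / u) = t * (1 - u * q) / (u * p ^ 3) := by
    field_simp
    ring
  rw [e1, e2, div_lt_one (by positivity), div_lt_one (by positivity)]
  constructor
  · rintro ⟨h1, h2⟩
    constructor
    · -- `t (1 - u q) < u p³` iff `t < u (q t + p³)`
      have h3 : t < u * (q * t + p ^ 3) := by
        have := mul_lt_mul_of_pos_right h1 ht
        rw [one_mul] at this
        calc t < u * (q + p ^ 3 / t) * t := this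
          _ = u * (q * t + p ^ 3) := by field_simp
      nlinarith
    · have := (lt_div_iff₀ ht).1 h2
      linarith
  · rintro ⟨h1, h2⟩
    constructor
    · have h3 : t < u * (q * t + p ^ 3) := by nlinarith
      have h4 : 1 * t < u * (q + p ^ 3 / t) * t := by
        calc 1 * t = t := one_mul t
          _ < u * (q * t + p ^ 3) := h3
          _ = u * (q + p ^ 3 / t) * t := by field_simp
      exact lt_of_mul_lt_mul_right h4 ht.le
    · rw [lt_div_iff₀ ht]
      linarith

/-- **Derivative of the inverse function**: if `h` is a continuous local inverse of `f` at
`u` (`f (h y) = y` near `u`) and `f' (h u) = p ≠ 0`, then `h' (u) = 1/p` (Mathlib's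
`HasDerivAt.of_local_left_inverse`, restated). [folklore] -/
theorem hasDerivAt_inverse {f h : ℝ → ℝ} {u p : ℝ} (hh : ContinuousAt h u)
    (hf : HasDerivAt f p (h u)) (hp : p ≠ 0) (hfh : ∀ᶠ y in 𝓝 u, f (h y) = y) :
    HasDerivAt h (1 / p) u := by
  rw [one_div]
  exact hf.of_local_left_inverse hh hp hfh

/-- **Second derivative of the inverse function**: if near `u` the function `h` is a
continuous local inverse of `f`, `f` has derivative `f'` near `h u` with `f' (h u) = p ≠ 0`,
and `f'` has derivative `q` at `h u` and is continuous there, then `h'` (`= 1/(f' ∘ h)` near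
`u`) has derivative `-q/p³` at `u`. [cite: ForstnericKozak2003, Remark 2.3 (A)] -/
theorem hasDerivAt_deriv_inverse {f f' h : ℝ → ℝ} {u p q : ℝ} (hh : ∀ᶠ y in 𝓝 u, ContinuousAt h y)
    (hf : ∀ᶠ x in 𝓝 (h u), HasDerivAt f (f' x) x) (hp : f' (h u) = p) (hp0 : p ≠ 0)
    (hf'c : ContinuousAt f' (h u)) (hf' : HasDerivAt f' q (h u))
    (hfh : ∀ᶠ y in 𝓝 u, f (h y) = y) :
    HasDerivAt (deriv h) (-q / p ^ 3) u := by
  have hhu : ContinuousAt h u := hh.self_of_nhds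
  -- `f' (h y) ≠ 0` and `HasDerivAt f (f' (h y)) (h y)` for `y` near `u`
  have h1 : ∀ᶠ y in 𝓝 u, HasDerivAt f (f' (h y)) (h y) := hhu.eventually hf
  have h2 : ∀ᶠ y in 𝓝 u, f' (h y) ≠ 0 := by
    have : ∀ᶠ x in 𝓝 (h u), f' x ≠ 0 := hf'c.eventually_ne (by rw [hp]; exact hp0)
    exact hhu.eventually this
  -- so `deriv h y = (f' (h y))⁻¹` near `u`
  have h3 : ∀ᶠ y in 𝓝 u, deriv h y = (f' (h y))⁻¹ := by
    filter_upwards [h1, h2, hh, hfh.eventually_nhds] with y h1 h2 hhy hfy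
    exact (h1.of_local_left_inverse hhy h2 hfy).deriv
  -- differentiate `y ↦ (f' (h y))⁻¹`
  have h4 : HasDerivAt h (f' (h u))⁻¹ u := (h1.self_of_nhds).of_local_left_inverse hhu
    (by rw [hp]; exact hp0) hfh
  have h5 : HasDerivAt (fun y => f' (h y)) (q * (f' (h u))⁻¹) u := hf'.comp u h4
  have h6 : HasDerivAt (fun y => (f' (h y))⁻¹) (-(q * (f' (h u))⁻¹) / (f' (h u)) ^ 2) u :=
    h5.inv (by rw [hp]; exact hp0)
  rw [hp] at h6
  have h7 : -(q * p⁻¹) / p ^ 2 = -q / p ^ 3 := by field_simp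
  rw [h7] at h6
  exact h6.congr_of_eventuallyEq h3

/-- **Remark 2.3 (A) of Forstnerič–Kozak at a point.**  Let `h` be a continuous local inverse of
`f` near `u` (`f ∘ h = id` near `u`, `t := h u > 0`, `u > 0`), `f` with derivative `f'` near
`t`, `f' t = p > 0`, `f'` continuous at `t` with derivative `q` there.  Then the inequalities
`f(t) (f''(t) + f'(t)³/t) > 1 ∧ f(t) f'(t)/t > 1` (here `f t = u`) hold iff
`h(u) (h''(u) + h'(u)³/u) < 1 ∧ h(u) h'(u)/u < 1`. [cite: ForstnericKozak2003, Remark 2.3 (A)] -/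
theorem shape_inverse_iff {f f' h : ℝ → ℝ} {u p q : ℝ} (hu : 0 < u) (ht : 0 < h u)
    (hh : ∀ᶠ y in 𝓝 u, ContinuousAt h y) (hf : ∀ᶠ x in 𝓝 (h u), HasDerivAt f (f' x) x)
    (hp : f' (h u) = p) (hp0 : 0 < p) (hf'c : ContinuousAt f' (h u)) (hf' : HasDerivAt f' q (h u))
    (hfh : ∀ᶠ y in 𝓝 u, f (h y) = y) :
    (1 < u * (q + p ^ 3 / h u) ∧ 1 < u * p / h u) ↔
      (h u * (deriv (deriv h) u + deriv h u ^ 3 / u) < 1 ∧ h u * deriv h u / u < 1) := by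
  have hd1 : deriv h u = 1 / p :=
    (hasDerivAt_inverse hh.self_of_nhds (by rw [← hp]; exact hf.self_of_nhds) hp0.ne' hfh).deriv
  have hd2 : deriv (deriv h) u = -q / p ^ 3 :=
    (hasDerivAt_deriv_inverse hh hf hp hp0.ne' hf'c hf' hfh).deriv
  rw [hd1, hd2]
  exact shape_inverse_alg_iff ht hu hp0

end Literature.Geometry.Symplectic

end
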